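import Summits.QuantumFields.YangMills.Theorems.AtomicCalibrationRPieceUniform
import Summits.QuantumFields.YangMills.Theorems.AtomicCalibrationRFarPiece
import Summits.QuantumFields.YangMills.Theorems.AtomicCalibrationRPairCutoffProduct

/-!
# AtomicCalibrationR (stmt-QuantumFields-28169), E2 `stub_offDiagonalWhitney` — inputs of the mass sum (vi) for construction (T)
# (roadmap v2 items B.1'/B.2; prover w4 g22, free hands)

* `norm_iteratedFDeriv_farPiece_uniform_le` — the z-uniform `M/ρ^m` form of clause (v) for the FAR pieces
  `G·(pairCut 0 · gridBump φ n h c)` (companion of `PieceUniform.norm_iteratedFDeriv_bandPiece_uniform_le`):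
  `‖D^m P(z)‖ ≤ [2^M 2^{k'} ‖F‖_M (1+‖centre‖)^{−k'} (2h(1+R))^m] / (2h)^m`;
* `distFat_gridCentre_le_of_alive` — a band piece that is alive at some point has its cube centre near the coincidence locus:
  `distFat (gridCentre n h c) ≤ 2·2^{−k} + 4h` (the `δ` to feed `BandBridge.ncard_near_shell_le`), for `n ≥ 2`;
* `bandPiece_eq_zero_of_lt_two` — for `n < 2` every band piece vanishes identically (no pairs).

No stub/crux/rung/summit is closed; nothing here touches Yang–Mills; the YM mass gap is NOT proved. [folklore]
-/

set_option autoImplicit false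

noncomputable section

open scoped BigOperators ContDiff
open Set Metric Function
open Summit.QuantumFields.YangMills.Cruxes.AtomicCalibrationR.PairCutoff (pairCut pairs pairCut_eq_one_of_far)
open Summit.QuantumFields.YangMills.Cruxes.AtomicCalibrationR.GridPartition (gridBump gridCentre tsupport_gridBump_subset
  norm_sub_gridCentre_le_of_gridBump_ne_zero)
open Summit.QuantumFields.YangMills.Cruxes.AtomicCalibrationR.FarPiece (norm_iteratedFDeriv_farPiece_le)
open Summit.QuantumFields.YangMills.Cruxes.AtomicCalibrationR.PieceUniform (one_add_norm_centre_le)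
open Summit.QuantumFields.YangMills.Cruxes.AtomicCalibrationR.PairCutoffProduct (pairCut_succ_sub_ne_zero)
open Summit.QuantumFields.YangMills.Cruxes.AtomicCalibrationR.OffDiagonalFlatness (distFat distFat_le abs_distFat_sub_distFat_le)
open Literature.MathematicalPhysics.QuantumLattice (schwartzNorm schwartzNorm_nonneg)

namespace Summit.QuantumFields.YangMills.Cruxes.AtomicCalibrationR.MassInputs

variable {n : ℕ}

/-- **Clause (v), uniform form, far pieces.** [folklore] -/
theorem norm_iteratedFDeriv_farPiece_uniform_le (F : SchwartzMap (Fin n → EuclideanSpace ℝ (Fin 4)) ℂ)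
    {G : (Fin n → EuclideanSpace ℝ (Fin 4)) → ℝ} (hG : ContDiff ℝ ∞ G)
    (hGF : ∀ (j : ℕ) (w : Fin n → EuclideanSpace ℝ (Fin 4)), ‖iteratedFDeriv ℝ j G w‖ ≤ ‖iteratedFDeriv ℝ j F w‖)
    {φ : ℝ → ℝ} (hφ : ContDiff ℝ ∞ φ) (hφs : tsupport φ ⊆ Icc (-1 : ℝ) 1) {h : ℝ} (hh : 0 < h) (hh2 : 2 * h ≤ 1 / 2)
    (c : Fin n × Fin 4 → ℤ) (k' m : ℕ) {R : ℝ} (hR : 0 ≤ R)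
    (hb : ∀ (z : Fin n → EuclideanSpace ℝ (Fin 4)) (i : ℕ), i ≤ m →
      ‖iteratedFDeriv ℝ i (fun w => pairCut n 0 w * gridBump φ n h c w) z‖ ≤ R ^ i)
    (z : Fin n → EuclideanSpace ℝ (Fin 4)) :
    ‖iteratedFDeriv ℝ m (fun w => G w * (pairCut n 0 w * gridBump φ n h c w)) z‖ ≤
      (2 ^ max k' m * 2 ^ k' * schwartzNorm (max k' m) F / (1 + ‖gridCentre n h c‖) ^ k' * (2 * h * (1 + R)) ^ m) /
        (2 * h) ^ m := by
  have hS : 0 ≤ schwartzNorm (max k' m) F := schwartzNorm_nonneg _ _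
  have h2h : 0 < 2 * h := by linarith
  have hRHS : 0 ≤ (2 ^ max k' m * 2 ^ k' * schwartzNorm (max k' m) F / (1 + ‖gridCentre n h c‖) ^ k' *
      (2 * h * (1 + R)) ^ m) / (2 * h) ^ m := by positivity
  have hb_smooth : ContDiff ℝ ∞ (fun w => pairCut n 0 w * gridBump φ n h c w) :=
    (Summit.QuantumFields.YangMills.Cruxes.AtomicCalibrationR.PairCutoff.contDiff_pairCut n 0).mul
      (Summit.QuantumFields.YangMills.Cruxes.AtomicCalibrationR.GridPartition.contDiff_gridBump hφ n h c)
  by_cases hz : z ∈ tsupport (fun w => G w * (pairCut n 0 w * gridBump φ n h c w))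
  · have hcube : ∀ l, ‖z l - gridCentre n h c l‖ ≤ 2 * h := by
      have hsub : tsupport (fun w => G w * (pairCut n 0 w * gridBump φ n h c w)) ⊆ tsupport (gridBump φ n h c) :=
        (tsupport_mul_subset_right (f := fun w => G w) (g := fun w => pairCut n 0 w * gridBump φ n h c w)).trans
          (tsupport_mul_subset_right (f := fun w => pairCut n 0 w) (g := gridBump φ n h c))
      exact tsupport_gridBump_subset hφs n hh c (hsub hz)
    have hcmp := one_add_norm_centre_le hh hh2 c hcube
    have h1 := norm_iteratedFDeriv_farPiece_le F hG hGF hb_smooth k' m z (hb z)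
    refine h1.trans ?_
    have hdec : 2 ^ max k' m * schwartzNorm (max k' m) F / (1 + ‖z‖) ^ k' ≤
        2 ^ max k' m * 2 ^ k' * schwartzNorm (max k' m) F / (1 + ‖gridCentre n h c‖) ^ k' := by
      rw [div_le_div_iff₀ (by positivity) (by positivity)]
      have hpow : (1 + ‖gridCentre n h c‖) ^ k' ≤ 2 ^ k' * (1 + ‖z‖) ^ k' := by
        rw [← mul_pow]; exact pow_le_pow_left₀ (by positivity) hcmp k'
      calc 2 ^ max k' m * schwartzNorm (max k' m) F * (1 + ‖gridCentre n h c‖) ^ k'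
          ≤ 2 ^ max k' m * schwartzNorm (max k' m) F * (2 ^ k' * (1 + ‖z‖) ^ k') :=
            mul_le_mul_of_nonneg_left hpow (by positivity)
        _ = 2 ^ max k' m * 2 ^ k' * schwartzNorm (max k' m) F * (1 + ‖z‖) ^ k' := by ring
    have hRm : (1 + R) ^ m = (2 * h * (1 + R)) ^ m / (2 * h) ^ m := by
      rw [mul_pow, mul_comm, mul_div_assoc, div_self (pow_ne_zero _ h2h.ne'), mul_one]
    rw [hRm, ← mul_div_assoc]
    refine div_le_div_of_nonneg_right ?_ (by positivity)
    exact mul_le_mul_of_nonneg_right hdec (by positivity)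
  · have h0 : iteratedFDeriv ℝ m (fun w => G w * (pairCut n 0 w * gridBump φ n h c w)) z = 0 := by
      by_contra hne
      exact hz (support_iteratedFDeriv_subset m (mem_support.2 hne))
    rw [h0, norm_zero]
    exact hRHS

/-- **Alive band pieces sit near the locus** (`n ≥ 2`): if the bump part `(pairCut (k+1) − pairCut k)·gridBump φ n h c` is non-zero
at some point, then `distFat (gridCentre n h c) ≤ 2·2^{−k} + 4h`. -/
theorem distFat_gridCentre_le_of_alive (hn : 2 ≤ n) {φ : ℝ → ℝ} (hφs : tsupport φ ⊆ Icc (-1 : ℝ) 1) {h : ℝ} (hh : 0 < h)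
    {k : ℕ} {c : Fin n × Fin 4 → ℤ} {z : Fin n → EuclideanSpace ℝ (Fin 4)}
    (hz : (pairCut n (k + 1) z - pairCut n k z) * gridBump φ n h c z ≠ 0) :
    distFat (gridCentre n h c) ≤ 2 * (2 : ℝ)⁻¹ ^ k + 4 * h := by
  have ht : pairCut n (k + 1) z - pairCut n k z ≠ 0 := left_ne_zero_of_mul hz
  have hg : gridBump φ n h c z ≠ 0 := right_ne_zero_of_mul hz
  obtain ⟨-, l, l', hll', hlt⟩ := pairCut_succ_sub_ne_zero ht
  have hdz : distFat z < 2 * (2 : ℝ)⁻¹ ^ k := (distFat_le z hll').trans_lt hlt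
  have hsup : ‖z - gridCentre n h c‖ ≤ 2 * h :=
    (pi_norm_le_iff_of_nonneg (by linarith)).2 fun l => norm_sub_gridCentre_le_of_gridBump_ne_zero hφs hh hg l
  have hlip := abs_distFat_sub_distFat_le z (gridCentre n h c)
  have := (abs_le.1 hlip).1
  have _hn := hn
  linarith

/-- For `n < 2` there are no pairs: `pairCut n k ≡ 1`, so every band piece vanishes identically. -/
theorem bandPiece_eq_zero_of_lt_two (hn : n < 2) (k : ℕ) (g : (Fin n → EuclideanSpace ℝ (Fin 4)) → ℝ)
    (z : Fin n → EuclideanSpace ℝ (Fin 4)) : (pairCut n (k + 1) z - pairCut n k z) * g z = 0 := by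
  have hno : ∀ l l' : Fin n, l ≠ l' → False := by
    intro l l' hll'
    have : Fintype.card (Fin n) < 2 := by simpa using hn
    exact hll' (Fintype.card_le_one_iff.1 (by omega) l l')
  have h1 : ∀ j : ℕ, pairCut n j z = 1 := fun j =>
    pairCut_eq_one_of_far fun l l' hll' => (hno l l' hll').elim
  rw [h1, h1, sub_self, zero_mul]

end Summit.QuantumFields.YangMills.Cruxes.AtomicCalibrationR.MassInputs

end
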